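import Summits.ValiantsHypothesis.ValiantsHypothesis.Theorems.LacunarySymmetroidMatrixDescartesDoorA26WallBubblingPureDSieve
import Literature.Computability.AlgebraicComplexity.RealTauKnownCases

/-!
# Wall bubbling for `DoorA26` — (W) third rung: ON THE WEYL STRATUM THE DETERMINANT FACTORS (`≤ 6` positive det-roots)

HONEST FRAMING.  Rung file for obligation (W) `stub_weylFaces` of `Cruxes/DoorA26/Lines/wall_bubbling.lean` (stmt-ValiantsHypothesis-19979
`DoorA26`; OPEN, typed, never asserted), re-pointed seat val-sym-door-p1 g13 (W2).  By `…WallBubblingWeylAnatomy` a realised first-order blow-up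
pattern at a generic Weyl face `δᵢ = δⱼ` has its letters on the STRATUM `Σ_W`: the four other letters and `S i + S j` are multiples of ONE
`det`-null matrix `N`.  This file records the EXACT algebra on that stratum: writing `S k = c k • N` (`k ∉ {i,j}`), `S i = c i • N − T`,
`S j = T` (any symmetric `T`), the pencil is `Φ • N + (X^{d j} − X^{d i}) • T` with `Φ = Σ_{l ≠ j} c l X^{d l}`, and since `det N = 0`

  `det (Σ_l X^{d l} • S l) = (X^{d j} − X^{d i}) · ( 2·polar(N,T) · Φ + det T · (X^{d j} − X^{d i}) )`     (`weylStratum_det_factor`);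

the first factor has the single positive root `1` (`d i ≠ d j`), the cofactor is supported on the six exponents `d` — at most `5` positive roots by
Descartes — so **a pencil on the Weyl stratum has at most `6` distinct positive det-roots** (`weylStratum_card_posRoots_le_six`).  In the blown-up
cluster of the line's second level this is the generic regime «`f/w ≈ 2β·u e^{δ_i u}Φ(u)`» (seat report DOOR-A-P1-REPORT §68 (e)): the factor `u` is
the root `x = 1` of `x^{d j} − x^{d i}`.  The accumulation statement (W) concerns pencils NEAR the stratum with exponents NEAR the face and stays
OPEN; nothing here bears on `DoorA26`, `MatrixDescartes` (stmt-ValiantsHypothesis-18050) or `VP ≠ VNP`.  No new definitions.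

[folklore] `det(pN + qT) = p² det N + 2pq·polar(N,T) + q² det T` for `2 × 2` matrices; Descartes' rule of signs.
-/

-- `Summit.ValiantsHypothesis.ValiantsHypothesis.…` repeats a component by the D-0017 layout
-- (single-conjunct summit), which the `dupNamespace` linter flags; the name is mandated.
set_option linter.dupNamespace false

namespace Summit.ValiantsHypothesis.ValiantsHypothesis.Theorems.LacunarySymmetroidMatrixDescartes.WallBubbling

open Finset Matrix Polynomial
open scoped BigOperators Polynomial

/-- Entries of a polynomial pencil. [folklore] -/
theorem polyPencil_apply (d : Fin 6 → ℕ) (S : Fin 6 → Matrix (Fin 2) (Fin 2) ℝ) (p q : Fin 2) :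
    (∑ l, (X : ℝ[X]) ^ d l • (S l).map C) p q = ∑ l, (X : ℝ[X]) ^ d l * C ((S l) p q) := by
  simp [Matrix.sum_apply, Matrix.smul_apply, Matrix.map_apply]

/-- **FACTORISATION ON THE WEYL STRATUM.**  With `S k = c k • N` (`k ∉ {i,j}`), `S i = c i • N − T`, `S j = T` and `det N = 0`:
`det(Σ_l X^{d l} • S l) = (X^{d j} − X^{d i}) · ((2·polar(N,T)) · Φ + det T · (X^{d j} − X^{d i}))`, `Φ = Σ_{l ≠ j} c l X^{d l}`,
where `2·polar(N,T) = det(N+T) − det N − det T`. [folklore] -/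
theorem weylStratum_det_factor (d : Fin 6 → ℕ) (i j : Fin 6) (hij : i ≠ j) (N T : Matrix (Fin 2) (Fin 2) ℝ) (hN : N.det = 0)
    (c : Fin 6 → ℝ) (S : Fin 6 → Matrix (Fin 2) (Fin 2) ℝ)
    (hSk : ∀ k, k ≠ i → k ≠ j → S k = c k • N) (hSi : S i = c i • N - T) (hSj : S j = T) :
    (∑ l, (X : ℝ[X]) ^ d l • (S l).map C).det
      = ((X : ℝ[X]) ^ d j - X ^ d i) *
        (C ((N + T).det - N.det - T.det) * (∑ l ∈ Finset.univ.erase j, C (c l) * X ^ d l)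
          + C T.det * ((X : ℝ[X]) ^ d j - X ^ d i)) := by
  classical
  -- every entry of the pencil is `Φ · N p q + D · T p q`
  have hjmem : j ∈ (Finset.univ : Finset (Fin 6)) := Finset.mem_univ j
  have himem : i ∈ Finset.univ.erase j := Finset.mem_erase.mpr ⟨hij, Finset.mem_univ i⟩
  have hentry : ∀ p q, (∑ l, (X : ℝ[X]) ^ d l • (S l).map C) p q
      = (∑ l ∈ Finset.univ.erase j, C (c l) * X ^ d l) * C (N p q) + ((X : ℝ[X]) ^ d j - X ^ d i) * C (T p q) := by
    intro p q
    rw [polyPencil_apply, ← Finset.add_sum_erase _ _ hjmem, ← Finset.add_sum_erase _ _ himem,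
      ← Finset.add_sum_erase _ _ himem, hSj, hSi]
    have hrest : ∑ l ∈ (Finset.univ.erase j).erase i, (X : ℝ[X]) ^ d l * C ((S l) p q)
        = ∑ l ∈ (Finset.univ.erase j).erase i, C (c l) * X ^ d l * C (N p q) := by
      refine Finset.sum_congr rfl fun l hl => ?_
      have hl' : l ≠ i ∧ l ≠ j := by
        simp only [Finset.mem_erase, Finset.mem_univ, and_true] at hl
        exact ⟨hl.1, hl.2⟩
      rw [hSk l hl'.1 hl'.2, Matrix.smul_apply, smul_eq_mul, map_mul]; ring
    rw [hrest, Matrix.sub_apply, Matrix.smul_apply, smul_eq_mul, map_sub, map_mul, add_mul, Finset.sum_mul]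
    ring
  have hN' : (C (N 0 0 * N 1 1 - N 0 1 * N 1 0) : ℝ[X]) = 0 := by rw [← Matrix.det_fin_two, hN, map_zero]
  simp only [map_sub, map_mul] at hN'
  rw [Matrix.det_fin_two, hentry, hentry, hentry, hentry]
  simp only [Matrix.det_fin_two, Matrix.add_apply, map_sub, map_add, map_mul]
  linear_combination ((∑ l ∈ Finset.univ.erase j, C (c l) * X ^ d l) ^ 2) * hN'

/-- A six-nomial factor: at most `5` distinct positive roots. [folklore] -/
theorem card_posRoots_le_five_of_support (f : ℝ[X]) (hf : f ≠ 0) (h6 : f.support.card ≤ 6) :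
    (f.roots.toFinset.filter (fun x => 0 < x)).card ≤ 5 := by
  classical
  have h1 : (f.roots.toFinset.filter (fun x => 0 < x)).card ≤ f.signVariations := by
    calc (f.roots.toFinset.filter (fun x => 0 < x)).card
        = (f.roots.filter (fun x => 0 < x)).toFinset.card := by rw [Multiset.toFinset_filter]
      _ ≤ (f.roots.filter (fun x => 0 < x)).card := Multiset.toFinset_card_le _
      _ = f.roots.countP (fun x => 0 < x) := (Multiset.countP_eq_card_filter _ _).symm
      _ ≤ f.signVariations := f.roots_countP_pos_le_signVariations
  have h2 := Literature.Computability.AlgebraicComplexity.signVariations_lt_card_support hf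
  omega

/-- **AT MOST SIX POSITIVE DET-ROOTS ON THE WEYL STRATUM.** [folklore] -/
theorem weylStratum_card_posRoots_le_six (d : Fin 6 → ℕ) (i j : Fin 6) (hij : i ≠ j) (hd : d i ≠ d j)
    (N T : Matrix (Fin 2) (Fin 2) ℝ) (hN : N.det = 0)
    (c : Fin 6 → ℝ) (S : Fin 6 → Matrix (Fin 2) (Fin 2) ℝ)
    (hSk : ∀ k, k ≠ i → k ≠ j → S k = c k • N) (hSi : S i = c i • N - T) (hSj : S j = T) :
    ((∑ l, (X : ℝ[X]) ^ d l • (S l).map C).det.roots.toFinset.filter (fun x => 0 < x)).card ≤ 6 := by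
  classical
  rw [weylStratum_det_factor d i j hij N T hN c S hSk hSi hSj]
  set D : ℝ[X] := (X : ℝ[X]) ^ d j - X ^ d i with hD
  set B : ℝ[X] := C ((N + T).det - N.det - T.det) * (∑ l ∈ Finset.univ.erase j, C (c l) * X ^ d l)
      + C T.det * D with hB
  by_cases hDB : D * B = 0
  · rw [hDB, Polynomial.roots_zero]; simp
  have hD0 : D ≠ 0 := left_ne_zero_of_mul hDB
  have hB0 : B ≠ 0 := right_ne_zero_of_mul hDB
  -- positive roots of `D`: only `1`
  have hDroots : (D.roots.toFinset.filter (fun x => 0 < x)) ⊆ {1} := by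
    intro x hx
    rw [Finset.mem_filter, Multiset.mem_toFinset, Polynomial.mem_roots hD0, Polynomial.IsRoot, hD] at hx
    obtain ⟨hx, hx0⟩ := hx
    simp only [eval_sub, eval_pow, eval_X, sub_eq_zero] at hx
    rw [Finset.mem_singleton]
    rcases lt_or_gt_of_ne hd with h | h
    · by_contra hne
      rcases lt_or_gt_of_ne hne with hx1 | hx1
      · exact absurd hx (ne_of_lt (pow_lt_pow_right_of_lt_one₀ hx0 hx1 h))
      · exact absurd hx (ne_of_gt (pow_lt_pow_right₀ hx1 h))
    · by_contra hne
      rcases lt_or_gt_of_ne hne with hx1 | hx1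
      · exact absurd hx (ne_of_gt (pow_lt_pow_right_of_lt_one₀ hx0 hx1 h))
      · exact absurd hx (ne_of_lt (pow_lt_pow_right₀ hx1 h))
  -- positive roots of `B`: at most five (six monomials)
  have hBsupp : B.support.card ≤ 6 := by
    have hsub : B.support ⊆ Finset.univ.image d := by
      intro n hn
      rw [Finset.mem_image]
      by_contra hcon
      push Not at hcon
      have : B.coeff n = 0 := by
        rw [hB, hD]
        simp only [coeff_add, coeff_C_mul, finsetSum_coeff, coeff_sub, coeff_X_pow]
        rw [Finset.sum_eq_zero (fun l _ => by rw [if_neg (fun h => hcon l (Finset.mem_univ l) h.symm)]; ring)]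
        rw [if_neg (fun h => hcon j (Finset.mem_univ j) h.symm), if_neg (fun h => hcon i (Finset.mem_univ i) h.symm)]
        ring
      exact (Polynomial.mem_support_iff.mp hn) this
    calc B.support.card ≤ (Finset.univ.image d).card := Finset.card_le_card hsub
      _ ≤ (Finset.univ : Finset (Fin 6)).card := Finset.card_image_le
      _ = 6 := by simp
  have hBroots := card_posRoots_le_five_of_support B hB0 hBsupp
  calc ((D * B).roots.toFinset.filter (fun x => 0 < x)).card
      = ((D.roots + B.roots).toFinset.filter (fun x => 0 < x)).card := by rw [Polynomial.roots_mul hDB]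
    _ ≤ ((D.roots.toFinset.filter (fun x => 0 < x)) ∪ (B.roots.toFinset.filter (fun x => 0 < x))).card := by
        apply Finset.card_le_card
        intro x hx
        rw [Finset.mem_filter, Multiset.mem_toFinset, Multiset.mem_add] at hx
        rw [Finset.mem_union, Finset.mem_filter, Finset.mem_filter, Multiset.mem_toFinset, Multiset.mem_toFinset]
        rcases hx.1 with h | h
        · exact Or.inl ⟨h, hx.2⟩
        · exact Or.inr ⟨h, hx.2⟩
    _ ≤ (D.roots.toFinset.filter (fun x => 0 < x)).card + (B.roots.toFinset.filter (fun x => 0 < x)).card :=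
        Finset.card_union_le _ _
    _ ≤ 1 + 5 := Nat.add_le_add ((Finset.card_le_card hDroots).trans (by simp)) hBroots
    _ = 6 := rfl

end Summit.ValiantsHypothesis.ValiantsHypothesis.Theorems.LacunarySymmetroidMatrixDescartes.WallBubbling
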